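import Summits.QuantumFields.YangMills.Theorems.UnitScaleTiltProp7DbarTwWindow
import Summits.QuantumFields.YangMills.Theorems.UnitScaleTiltProp7SymAvgTwFrameAxial
import Summits.QuantumFields.YangMills.Theorems.UnitScaleTiltProp7NMax19Algebra
import Summits.QuantumFields.YangMills.Theorems.UnitScaleTiltProp7SymFrameUnitary
import Literature.MathematicalPhysics.QuantumFieldTheory.Balaban1983to89.LogChartClosedSubgroup
import Literature.MathematicalPhysics.QuantumFieldTheory.Balaban1983to89.B12SemisimpleNormalTori
import Literature.RepresentationTheory.CompactGroups.MatrixGroupExpSurjective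
import HarnessLib

/-!
# Route `UnitScaleTilt`, crux K1 «MinimiserStabilityRegPr» (stmt-QuantumFields-19200), route-R E′ architecture (A′)-on-Σ (★★OWNER RULINGS g28-№13 ∕ g29-№16), the JOINT row of
# the Σ-rows door ✓`Prop7HcoSOfSigmaRows.hcoS_of_sigmaRowsS` — brick «F0-COMB» (★p1 g17 WORD 24): **THE COMB FRAME RESPONSE IS `𝔰𝔲(2)`-VALUED**

Cell `ym3-torus`, D-0154 (3c) twin-width seat `ym-routeR-w2` (gen 8), 2026-08-29 (SIGN-IN offer 03:21Z; ★p1 g17 WORD 24 (b) «F0-COMB» names the brick).  THEOREMS ONLY (0 `def`, 0 `sorry`); `--supports stmt-QuantumFields-19200 --as helper`,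
count-neutral.  YM₃ on T³ is a ladder rung (R3), not the Clay problem; nothing here claims the stub, the crux, `hcoS`, E′, EX, d = 4 or the mass gap.

WHY.  The JOINT conjunct of the Σ-rows door asks for a coarse gauge function `μ : Site → M₂` with `μ y ∈ 𝔰𝔲(2)` (skew-adjoint, traceless) such that
`Σ_c ‖Q^{(K−n)}_W(iX)(c) − (μ(c₋) − W̄(c)μ(c₊)W̄(c)ᴴ)‖` is booked against the P-A2 binder.  By the P-A1 LEG for the comb-framed chart (✓`Prop7LegLemmaQTw.
QTw_apply_eq_trueLinIter_sub_coarseGauge_T3`) the gauge function of record is the LINEARISED COMB FRAME `r(y)A := (D_A w_A(y))|_{A=0}`, `w_A(y) = \overline{R_{0,y}e^{A}}^{(k)}`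
([Balaban1985Averaging] (82)∕(97); tree `Prop7SymAvgTw.frameTw`).  Its `𝔰𝔲(2)`-valuedness on real directions `A = iX` (`X` Hermitian traceless) is the content of this file:
the frames of `SU(2)` data are `SU(2)`-valued ((97) is a product of averaged `G`-valued transports — lit ✓`Prop7ChartSigmaT3GlevSU.dbavgCovIter_vcov_mem_specialUnitaryUnits`,
read through ✓`Prop7SymAvgTwFrameDiff.frameTw_eq_vcov`), so `t ↦ w_{tA}(y)` is a curve in the closed group `SU(2)` through `1` (✓`frameTw_zero`) whose velocity `r(y)A` lies in `𝔰𝔲(2)`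
(✓`MatrixLie.mem_lieSet_of_hasDerivAt`, ✓`LogChartClosedSubgroup.mem_su_iff_forall_exp_mem_specialUnitaryGroup`; the Fréchet derivative exists by ✓`hasFDerivAt_frameTw_of_regPr`).
The twin for the SYMMETRIC frames `frameTwS` is px21's ✓`Prop7FrameResponseSU2.frameResponse_skew_traceless`; the comb frames are lit-balaban's `vcov` and need Prop. 7's window
(1.141) for `e^{A}U₀`, which holds for `A` of (19)-size `< ε₀∕6` (✓`Prop7ChartSigmaT3OfRegPr.pdev_pull_emb15_le_of_regPr_of_nMax19`) — in particular for `tA`, `t` small, which is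
all the velocity lemma needs.

WHAT IS PROVED (ns `…Theorems.Prop7FrameResponseCombSU2`; T³, `SU(2)`, `10⁷L³ε₀ ≤ 1`, `RegPr F n K ε₀ W`).
* §1 numerics `windows_of_ten7` (Prop. 2's pairs at `α = 2ε₀, 3ε₀` + Prop. 4's exponential row), `tower_windows_of_ten7` ((WΣ)'s `hsmall hc₃ hsm` at `Lᵏb = ε₀∕6`).
* §2 ★ `frameTw_I_smul_mem_specialUnitaryGroup_of_nMax19_lt` — `X` Hermitian traceless with `nMax19 W X < ε₀∕6` ⟹ `↑(frameTw W (iX) y) ∈ SU(2)`;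
  ★ `frameTw_real_smul_mem_specialUnitaryGroup_eventually` — for every Hermitian traceless `X`: `∀ᶠ t : ℝ in 𝓝 0, ↑(frameTw W (t·iX) y) ∈ SU(2)`.
* §3 ★★ `combFrameResponse_mem_skewAdjoint_trace_zero` — for every skew-adjoint traceless `A`: `fderiv ℂ (A ↦ ↑(frameTw W A y)) 0 A ∈ skewAdjoint M₂ ∧ tr (…) = 0`.
HONEST SCOPE.  Lie-group bookkeeping over landed letters (frame unitarity of lit's tower, frame analyticity, the closed-subgroup velocity lemma); no estimate; nothing of print asserted.

References: T. Bałaban, CMP 98 (1985) 17–51 [Balaban1985Averaging] ((82) p.30, (87)–(92) p.31, (97)–(99) p.32, Prop. 4 p.38); CMP 99 (1985) 75–102 [Balaban1985RegularSpaces]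
(Prop. 7 (1.139)–(1.141) p.100); CMP 102 (1985) 277–309 [Balaban1985Variational] ((19) p.281, (51) p.286); B. C. Hall, Lie Groups, Lie Algebras, and Representations (2015) [Hall2015]
(Prop. 3.24, Cor. 3.45).
-/

set_option autoImplicit false

noncomputable section

open scoped Matrix.Norms.L2Operator Matrix Topology
open Filter Metric NormedSpace

namespace Summit.QuantumFields.YangMills.Theorems.Prop7FrameResponseCombSU2

open Literature.MathematicalPhysics.QuantumFieldTheory.Balaban1983to89
open Literature.MathematicalPhysics.QuantumFieldTheory.Balaban1983to89.T3ContinuumYM3Torus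
open Literature.RepresentationTheory.CompactGroups (MatrixLie.mem_lieSet_of_hasDerivAt MatrixLie.mem_lieSet)
open T3PrintedRegularMinimiser (RegPr)
open T3SectALandauChart (eta eta_pos bgUnits emb15)
open B7Prop1Explicit renaming Site → LSite
open B7Prop1Explicit (expUnit)
open B7Prop2Explicit (pdev C0 c2')
open B7Prop2SpecialUnitary (specialUnitaryUnits mem_specialUnitaryUnits)
open B7Prop3Flat (expCfg c3)
open B10Eq27TorusAxialLog (pull pull_apply transl unitsField toUField)
open Summit.QuantumFields.YangMills.Theorems.Prop7SPrint (basePt)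
open Summit.QuantumFields.YangMills.Theorems.Prop7TPrint (nMax19 nMax19_lt_iff expHermField expHermField_apply coe_expHerm)
open Summit.QuantumFields.YangMills.Theorems.Prop7AxialReprPrint (pull_toUField_mem inAk_pull_of_regPr pdev_pull_lt)
open Summit.QuantumFields.YangMills.Theorems.Prop7SymAvgGLSmallOfRegPr (bgUnits_eq)
open Summit.QuantumFields.YangMills.Theorems.Prop7SymAvgTw (coordT3 frameTw)
open Summit.QuantumFields.YangMills.Theorems.Prop7SymAvgTwFrameDiff (frameTw_eq_vcov hasFDerivAt_frameTw_of_regPr)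
open Summit.QuantumFields.YangMills.Theorems.Prop7SymAvgTwFrameAxial (frameTw_zero)
open Summit.QuantumFields.YangMills.Theorems.Prop7ChartSigmaT3 (pull_emb15)
open Summit.QuantumFields.YangMills.Theorems.Prop7ChartSigmaT3GlevSU (pull_eq_expCfg_of_exp dbavgCovIter_vcov_mem_specialUnitaryUnits)
open Summit.QuantumFields.YangMills.Theorems.Prop7ChartSigmaT3OfRegPr (pdev_pull_emb15_le_of_regPr_of_nMax19)
open Summit.QuantumFields.YangMills.Theorems.Prop7SPrintIn19 (pow_mul_eta)
open Summit.QuantumFields.YangMills.Theorems.Prop7NMax19Algebra (nMax19_smul_le nMax19_nonneg)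
open Summit.QuantumFields.YangMills.Theorems.Prop7SymFrameBound (coe_expUnit_I_smul_mem_specialUnitaryGroup)

variable (F : T3Family) {n K : ℕ} (h : n ≤ K)

/-! ## §1 Numerics at `10⁷L³ε₀ ≤ 1` -/

/-- **PROP. 2's PAIRS AT `α = 2ε₀` AND `α = 3ε₀` AND PROP. 4's EXPONENTIAL ROW** (`d = 3`: `C₀ = 11339776`, `c₂′ = 1∕(14336L²)`, exponent `716800·ε₀ ≤ 0.003`):
`C₀·2ε₀ ≤ ⅓`, `4·2ε₀ ≤ c₂′`, `e^{c·2ε₀} < 2`, `C₀·3ε₀ ≤ ⅓`, `2·3ε₀ ≤ c₂′`, all from `10⁷L³ε₀ ≤ 1` (the first three = ✓`Prop7LegLemmaQTw.comb_windows_of_ten7`, re-derived so that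
this file does not wait on that module's olean). [cite: Balaban1985Averaging, Prop. 2 (52)–(54) p.26, Prop. 4 p.38] -/
theorem windows_of_ten7 {ε₀ : ℝ} (hε₀ : 0 ≤ ε₀) (hε : 10 ^ 7 * (F.L : ℝ) ^ 3 * ε₀ ≤ 1) :
    C0 (F.P K).d * (2 * ε₀) ≤ 1 / 3 ∧ 4 * (2 * ε₀) ≤ c2' (F.P K).d (F.P K).L ∧
      Real.exp (4 * (800 * (((F.P K).d : ℝ) + 1) ^ 2 * (((F.P K).d : ℝ) + 4)) * (2 * ε₀)) < 2 ∧
      C0 (F.P K).d * (3 * ε₀) ≤ 1 / 3 ∧ 2 * (3 * ε₀) ≤ c2' (F.P K).d (F.P K).L := by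
  have hL : (3 : ℝ) ≤ F.L := by
    have h3 : 3 ≤ F.L := by obtain ⟨a, ha⟩ := F.hL.1; have := F.hL.2; omega
    exact_mod_cast h3
  have hd : (F.P K).d = 3 := T3Family.P_d F K
  have hPL : (F.P K).L = F.L := rfl
  rw [hd, hPL]
  have hL3 : (27 : ℝ) ≤ (F.L : ℝ) ^ 3 := by
    have h := pow_le_pow_left₀ (by norm_num : (0 : ℝ) ≤ 3) hL 3
    norm_num at h
    exact h
  -- `27·10⁷·ε₀ ≤ 1`
  have hεb : 27 * (10 ^ 7 * ε₀) ≤ 1 :=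
    le_trans (by nlinarith [mul_le_mul_of_nonneg_right hL3 (by positivity : (0 : ℝ) ≤ 10 ^ 7 * ε₀)]) hε
  -- `3·10⁷·L²·ε₀ ≤ 1`
  have h2 : 3 * (10 ^ 7 * (F.L : ℝ) ^ 2 * ε₀) ≤ 1 :=
    calc 3 * (10 ^ 7 * (F.L : ℝ) ^ 2 * ε₀) ≤ (F.L : ℝ) * (10 ^ 7 * (F.L : ℝ) ^ 2 * ε₀) :=
          mul_le_mul_of_nonneg_right hL (by positivity)
      _ = 10 ^ 7 * (F.L : ℝ) ^ 3 * ε₀ := by ring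
      _ ≤ 1 := hε
  have hC : C0 3 = 11339776 := by simp only [C0]; norm_num
  have hc : c2' 3 F.L = 1 / (14336 * (F.L : ℝ) ^ 2) := by simp only [c2']; norm_num
  have hL2 : (0 : ℝ) < 14336 * (F.L : ℝ) ^ 2 := by positivity
  refine ⟨?_, ?_, ?_, ?_, ?_⟩
  · rw [hC]; linarith
  · rw [hc, le_div_iff₀ hL2]; nlinarith [h2]
  · have hx : (4 * (800 * (((3 : ℕ) : ℝ) + 1) ^ 2 * (((3 : ℕ) : ℝ) + 4)) * (2 * ε₀)) = 716800 * ε₀ := by push_cast; ring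
    rw [hx]
    have hx0 : 0 ≤ 716800 * ε₀ := by positivity
    have hx1 : 716800 * ε₀ ≤ 3 / 1000 := by linarith
    have habs : |716800 * ε₀| ≤ 1 := by rw [abs_of_nonneg hx0]; linarith
    have hb := Real.abs_exp_sub_one_le habs
    rw [abs_of_nonneg hx0] at hb
    have hb' := (abs_le.1 hb).2
    linarith
  · rw [hC]; linarith
  · rw [hc, le_div_iff₀ hL2]; nlinarith [h2]

/-- **THE TOWER'S THREE SIZE WINDOWS AT `Lᵏb = ε₀∕6`** (`d = 3`, `c₃ = 1∕(512L)`): `e^{c·2ε₀}(1 + 8·(131072·16)·(ε₀∕6)) ≤ 2`, `2·(ε₀∕6) ≤ c₃`, `2048·3·(ε₀∕6) ≤ 1`, from `10⁷L³ε₀ ≤ 1`.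
[cite: Balaban1985Averaging, Prop. 4 p.38, (131) p.38] -/
theorem tower_windows_of_ten7 {ε₀ : ℝ} (hε₀ : 0 ≤ ε₀) (hε : 10 ^ 7 * (F.L : ℝ) ^ 3 * ε₀ ≤ 1) :
    Real.exp (4 * (800 * (((F.P K).d : ℝ) + 1) ^ 2 * (((F.P K).d : ℝ) + 4)) * (2 * ε₀))
        * (1 + 8 * (131072 * (((F.P K).d : ℝ) + 1) ^ 2) * (ε₀ / 6)) ≤ 2 ∧
      2 * (ε₀ / 6) ≤ c3 (F.P K).d (F.P K).L ∧ 2048 * ((F.P K).d : ℝ) * (ε₀ / 6) ≤ 1 := by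
  have hL : (3 : ℝ) ≤ F.L := by
    have h3' : 3 ≤ F.L := by obtain ⟨a, ha⟩ := F.hL.1; have := F.hL.2; omega
    exact_mod_cast h3'
  have hd : (F.P K).d = 3 := T3Family.P_d F K
  have hPL : (F.P K).L = F.L := rfl
  rw [hd, hPL]
  have hL3 : (27 : ℝ) ≤ (F.L : ℝ) ^ 3 := by
    have h := pow_le_pow_left₀ (by norm_num : (0 : ℝ) ≤ 3) hL 3
    norm_num at h
    exact h
  have hεb : 27 * (10 ^ 7 * ε₀) ≤ 1 :=
    le_trans (by nlinarith [mul_le_mul_of_nonneg_right hL3 (by positivity : (0 : ℝ) ≤ 10 ^ 7 * ε₀)]) hε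
  -- `9·10⁷·L·ε₀ ≤ 1`
  have h1 : 9 * (10 ^ 7 * (F.L : ℝ) * ε₀) ≤ 1 :=
    calc 9 * (10 ^ 7 * (F.L : ℝ) * ε₀) ≤ (F.L : ℝ) ^ 2 * (10 ^ 7 * (F.L : ℝ) * ε₀) :=
          mul_le_mul_of_nonneg_right (by nlinarith) (by positivity)
      _ = 10 ^ 7 * (F.L : ℝ) ^ 3 * ε₀ := by ring
      _ ≤ 1 := hε
  refine ⟨?_, ?_, ?_⟩
  · have hx : (4 * (800 * (((3 : ℕ) : ℝ) + 1) ^ 2 * (((3 : ℕ) : ℝ) + 4)) * (2 * ε₀)) = 716800 * ε₀ := by push_cast; ring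
    rw [hx]
    have hx0 : 0 ≤ 716800 * ε₀ := by positivity
    have hx1 : 716800 * ε₀ ≤ 3 / 1000 := by linarith
    have habs : |716800 * ε₀| ≤ 1 := by rw [abs_of_nonneg hx0]; linarith
    have hb := Real.abs_exp_sub_one_le habs
    rw [abs_of_nonneg hx0] at hb
    have hb' := (abs_le.1 hb).2
    have hy : (1 + 8 * (131072 * (((3 : ℕ) : ℝ) + 1) ^ 2) * (ε₀ / 6)) ≤ 1 + 3 / 100 := by push_cast; nlinarith
    have hy0 : 0 ≤ (1 + 8 * (131072 * (((3 : ℕ) : ℝ) + 1) ^ 2) * (ε₀ / 6)) := by positivity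
    calc Real.exp (716800 * ε₀) * (1 + 8 * (131072 * (((3 : ℕ) : ℝ) + 1) ^ 2) * (ε₀ / 6))
        ≤ (1 + 6 / 1000) * (1 + 3 / 100) := by
          apply mul_le_mul (by linarith) hy hy0 (by norm_num)
      _ ≤ 2 := by norm_num
  · have hc : c3 3 F.L = 1 / (512 * (F.L : ℝ)) := by simp only [c3]; norm_num
    have hL0 : (0 : ℝ) < 512 * (F.L : ℝ) := by positivity
    rw [hc, le_div_iff₀ hL0]
    nlinarith [h1]
  · push_cast; linarith

/-! ## §2 The comb frames of `SU(2)` data are `SU(2)`-valued -/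

/-- ★ **`↑(frameTw W (iX) y) ∈ SU(2)` FOR HERMITIAN TRACELESS `X` OF (19)-SIZE `< ε₀∕6`** at a printed-regular `W` (`RegPr F n K ε₀ W`, `10⁷L³ε₀ ≤ 1`): lit-balaban's tower lemma
✓`dbavgCovIter_vcov_mem_specialUnitaryUnits` (the frames `v_j` (97) of `SU(N)` data are `SU(N)`-valued) at `j = k = K − n` on the based pullbacks, read through ✓`frameTw_eq_vcov`;
its windows: (1.139) for `W♯` from `RegPr` (✓`pdev_pull_lt ∘ inAk_pull_of_regPr`), Prop. 2's pairs at `2ε₀` and `3ε₀` (§1), the size windows at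
`Lᵏb = ε₀∕6` (§1), and (1.141) for `(e^{iX}W)♯` with `αP = 3ε₀ > 2ε₀ + 3·(ε₀∕6)` (✓`pdev_pull_emb15_le_of_regPr_of_nMax19`).
[cite: Balaban1985Averaging, (97) p.32, (87)–(92) p.31; Balaban1985RegularSpaces, Prop. 7 (1.139)–(1.141) p.100; Balaban1985Variational, (19) p.281] -/
theorem frameTw_I_smul_mem_specialUnitaryGroup_of_nMax19_lt {ε₀ : ℝ} (hε₀ : 0 < ε₀) (hε : 10 ^ 7 * (F.L : ℝ) ^ 3 * ε₀ ≤ 1)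
    (W : GaugeField (F.P K) 0 (Matrix.specialUnitaryGroup (Fin 2) ℂ)) (hreg : RegPr F n K ε₀ W)
    (X : PBond (F.P K) 0 → Matrix (Fin 2) (Fin 2) ℂ) (hX : ∀ b, (X b).IsHermitian ∧ (X b).trace = 0) (hX6 : nMax19 F n K W X < ε₀ / 6)
    (y : Site (F.P n) 0) :
    ((frameTw F n K h W (fun b => Complex.I • X b) y : (Matrix (Fin 2) (Fin 2) ℂ)ˣ) : Matrix (Fin 2) (Fin 2) ℂ) ∈ Matrix.specialUnitaryGroup (Fin 2) ℂ := by
  letI : CStarAlgebra (Matrix (Fin 2) (Fin 2) ℂ) := B10Eq29TubeLine.cstarAlgebraMatrix 2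
  have hL2 : 2 ≤ (F.P K).L := (F.P K).hL.2
  have hd1 : 1 ≤ (F.P K).d := by rw [T3Family.P_d F K]; norm_num
  have hη : 0 < eta F n K := eta_pos F n K
  have hLη : ((F.P K).L : ℝ) ^ (K - n) * eta F n K = 1 := pow_mul_eta F n K
  set x₀ := basePt F n K with hx₀
  -- the exponent on the based pullback and its size `b = (ε₀∕6)·η`
  set B : LSite (F.P K).d → Fin (F.P K).d → Matrix (Fin 2) (Fin 2) ℂ := fun z κ => Complex.I • X ⟨transl x₀ z, κ⟩ with hB
  set b : ℝ := ε₀ / 6 * eta F n K with hb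
  have hb0 : 0 ≤ b := by positivity
  have hLb : ((F.P K).L : ℝ) ^ (K - n) * b = ε₀ / 6 := by rw [hb, mul_left_comm, hLη, mul_one]
  obtain ⟨h19, -, -, -⟩ := nMax19_lt_iff.1 hX6
  have hBb : ∀ z κ, ‖B z κ‖ ≤ b := fun z κ => by
    rw [hB]; dsimp only
    rw [norm_smul, Complex.norm_I, one_mul]
    exact (h19 _).le
  -- `SU(2)`-valuedness of the data
  have hU₀ : ∀ z κ, pull (bgUnits F K W) x₀ z κ ∈ specialUnitaryUnits (Fin 2) := fun z κ => by
    rw [bgUnits_eq]; exact pull_toUField_mem W _ z κ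
  have hBu : ∀ z κ, expCfg B z κ ∈ specialUnitaryUnits (Fin 2) := fun z κ => by
    rw [mem_specialUnitaryUnits]
    show ((expUnit (Complex.I • X ⟨transl x₀ z, κ⟩) : (Matrix (Fin 2) (Fin 2) ℂ)ˣ) : Matrix (Fin 2) (Fin 2) ℂ) ∈ Matrix.specialUnitaryGroup (Fin 2) ℂ
    exact coe_expUnit_I_smul_mem_specialUnitaryGroup (hX _).1 (hX _).2
  -- Prop. 2's windows at `2ε₀` and `3ε₀`, the size windows
  obtain ⟨hα3, hα4, -, hαP3, hαP2⟩ := windows_of_ten7 F (K := K) hε₀.le hε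
  obtain ⟨hsmall, hc₃, hsm⟩ := tower_windows_of_ten7 F (K := K) hε₀.le hε
  rw [← hLb] at hsmall hc₃ hsm
  -- (1.139) for `W♯`
  have h52 : pdev (pull (bgUnits F K W) x₀) < 2 * ε₀ * ((((F.P K).L : ℝ) ^ (K - n))⁻¹) ^ 2 := by
    rw [bgUnits_eq]; exact pdev_pull_lt (P := F.P K) hε₀ (inAk_pull_of_regPr F (n := n) (K := K) hε₀.le hreg) x₀
  -- (1.141) for `(e^{iX}W)♯` at `αP = 3ε₀`
  have hP : pdev (expCfg B * pull (bgUnits F K W) x₀) < 3 * ε₀ * ((((F.P K).L : ℝ) ^ (K - n))⁻¹) ^ 2 := by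
    have hU₁ : ∀ b' : PBond (F.P K) 0, ((expHermField X b' : Matrix.specialUnitaryGroup (Fin 2) ℂ) : Matrix (Fin 2) (Fin 2) ℂ) = exp (Complex.I • X b') :=
      fun b' => by rw [expHermField_apply, coe_expHerm (hX b')]
    have hε8 : 2 * ε₀ ≤ 1 / 8 := by
      have hL1 : (1 : ℝ) ≤ (F.L : ℝ) ^ 3 := one_le_pow₀ (by exact_mod_cast F.hL.2.le)
      nlinarith
    have he20 : ε₀ / 6 ≤ 1 / 20 := by
      have hL1 : (1 : ℝ) ≤ (F.L : ℝ) ^ 3 := one_le_pow₀ (by exact_mod_cast F.hL.2.le)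
      nlinarith
    have hle := pdev_pull_emb15_le_of_regPr_of_nMax19 F hε₀ (by positivity : (0 : ℝ) ≤ ε₀ / 6) hε8 he20 W (expHermField X) hreg X
      (fun b' => (hX b').1) hU₁ hX6
    rw [pull_emb15, pull_eq_expCfg_of_exp F (expHermField X) X hU₁ x₀, ← bgUnits_eq] at hle
    have hpos : 0 < ε₀ * ((((F.P K).L : ℝ) ^ (K - n))⁻¹) ^ 2 := by
      have : 0 < (((F.P K).L : ℝ) ^ (K - n))⁻¹ := inv_pos.2 (pow_pos (by exact_mod_cast (F.P K).L_pos) _)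
      positivity
    exact lt_of_le_of_lt hle (by nlinarith)
  -- the tower lemma
  have key := (dbavgCovIter_vcov_mem_specialUnitaryUnits (N := 2) (by norm_num) hd1 hL2 hU₀ hBu (by positivity : (0 : ℝ) < 2 * ε₀) hα3 hα4 h52 hb0 hBb
    hsmall hc₃ hsm (by positivity : (0 : ℝ) < 3 * ε₀) hαP3 hαP2 hP (K - n) le_rfl).2 (coordT3 F n K h y)
  rw [frameTw_eq_vcov]
  exact mem_specialUnitaryUnits.1 key

/-- ★ **ALONG EVERY REAL RAY THE COMB FRAMES ARE EVENTUALLY `SU(2)`-VALUED**: for Hermitian traceless `X` (any size) and `W ∈ 𝔘_k(ε₀)` (`10⁷L³ε₀ ≤ 1`):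
`∀ᶠ t : ℝ in 𝓝 0, ↑(frameTw W (t·iX) y) ∈ SU(2)` — `tX` is Hermitian traceless of (19)-size `≤ |t|·nMax19 W X < ε₀∕6` for small `t` (✓`nMax19_smul_le`).
[cite: Balaban1985Averaging, (97) p.32; Balaban1985Variational, (19) p.281, (51) p.286] -/
theorem frameTw_real_smul_mem_specialUnitaryGroup_eventually {ε₀ : ℝ} (hε₀ : 0 < ε₀) (hε : 10 ^ 7 * (F.L : ℝ) ^ 3 * ε₀ ≤ 1)
    (W : GaugeField (F.P K) 0 (Matrix.specialUnitaryGroup (Fin 2) ℂ)) (hreg : RegPr F n K ε₀ W)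
    (X : PBond (F.P K) 0 → Matrix (Fin 2) (Fin 2) ℂ) (hX : ∀ b, (X b).IsHermitian ∧ (X b).trace = 0) (y : Site (F.P n) 0) :
    ∀ᶠ t : ℝ in 𝓝 0, ((frameTw F n K h W ((t : ℂ) • fun b => Complex.I • X b) y : (Matrix (Fin 2) (Fin 2) ℂ)ˣ) : Matrix (Fin 2) (Fin 2) ℂ)
      ∈ Matrix.specialUnitaryGroup (Fin 2) ℂ := by
  -- `|t|·nMax19 W X < ε₀∕6` near `t = 0`
  have hcont : ContinuousAt (fun t : ℝ => |t| * nMax19 F n K W X) 0 := (continuous_abs.mul continuous_const).continuousAt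
  have h0 : (fun t : ℝ => |t| * nMax19 F n K W X) 0 < ε₀ / 6 := by simp only [abs_zero, zero_mul]; positivity
  filter_upwards [hcont.eventually_lt continuousAt_const h0] with t ht
  -- the datum `tX`
  have hXt : ∀ b, (((t : ℂ) • X) b).IsHermitian ∧ (((t : ℂ) • X) b).trace = 0 := fun b => by
    refine ⟨?_, ?_⟩
    · have h1 := (hX b).1
      rw [Pi.smul_apply, Matrix.IsHermitian, Matrix.conjTranspose_smul, h1.eq, Complex.star_def, Complex.conj_ofReal]
    · rw [Pi.smul_apply, Matrix.trace_smul, (hX b).2, smul_zero]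
  have hXt6 : nMax19 F n K W ((t : ℂ) • X) < ε₀ / 6 :=
    lt_of_le_of_lt (nMax19_smul_le W (t : ℂ) X) (by rwa [Complex.norm_real, Real.norm_eq_abs])
  have hfun : ((t : ℂ) • fun b => Complex.I • X b) = fun b => Complex.I • ((t : ℂ) • X) b := by
    funext b; simp only [Pi.smul_apply, smul_smul, mul_comm]
  rw [hfun]
  exact frameTw_I_smul_mem_specialUnitaryGroup_of_nMax19_lt F h hε₀ hε W hreg ((t : ℂ) • X) hXt hXt6 y

/-! ## §3 ★★ The comb frame response to a real direction is `𝔰𝔲(2)`-valued -/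

/-- ★★ **THE LINEARISED COMB FRAME `r(y)A = (D_A w_A(y))|_{A=0}` IS `𝔰𝔲(2)`-VALUED ON `𝔰𝔲(2)`-VALUED DIRECTIONS**: for `W ∈ 𝔘_k(ε₀)` (`10⁷L³ε₀ ≤ 1`) and a bondwise
skew-adjoint traceless `A`, `fderiv ℂ (A ↦ ↑(frameTw W A y)) 0 A ∈ skewAdjoint M₂(ℂ)` and `tr (…) = 0`: the curve `t ↦ ↑w_{tA}(y)` runs in `SU(2)` for small real `t` (§2 at
`X := −iA`), equals `1` at `t = 0` (✓`frameTw_zero`) and has velocity `r(y)A` there (✓`hasFDerivAt_frameTw_of_regPr`, windows §1); the closed-subgroup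
velocity lemma concludes.  This is the `𝔰𝔲(2)`-valuedness of the JOINT row's coarse gauge function `μ := r(·)(iX)` of record (✓P-A1 LEG-COMB-T³).
[cite: Balaban1985Averaging, (97) p.32, (87)–(92) p.31; Balaban1985Variational, (51) p.286, (123)–(126) pp.296–297; Hall2015, Prop. 3.24, Cor. 3.45] -/
theorem combFrameResponse_mem_skewAdjoint_trace_zero {ε₀ : ℝ} (hε₀ : 0 < ε₀) (hε : 10 ^ 7 * (F.L : ℝ) ^ 3 * ε₀ ≤ 1)
    (W : GaugeField (F.P K) 0 (Matrix.specialUnitaryGroup (Fin 2) ℂ)) (hreg : RegPr F n K ε₀ W)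
    {A : PBond (F.P K) 0 → Matrix (Fin 2) (Fin 2) ℂ} (hA : ∀ b, A b ∈ skewAdjoint (Matrix (Fin 2) (Fin 2) ℂ)) (htr : ∀ b, (A b).trace = 0) (y : Site (F.P n) 0) :
    fderiv ℂ (fun A : PBond (F.P K) 0 → Matrix (Fin 2) (Fin 2) ℂ => ((frameTw F n K h W A y : (Matrix (Fin 2) (Fin 2) ℂ)ˣ) : Matrix (Fin 2) (Fin 2) ℂ)) 0 A
        ∈ skewAdjoint (Matrix (Fin 2) (Fin 2) ℂ) ∧
      Matrix.trace (fderiv ℂ (fun A : PBond (F.P K) 0 → Matrix (Fin 2) (Fin 2) ℂ => ((frameTw F n K h W A y : (Matrix (Fin 2) (Fin 2) ℂ)ˣ) : Matrix (Fin 2) (Fin 2) ℂ)) 0 A) = 0 := by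
  -- letters
  set w : (PBond (F.P K) 0 → Matrix (Fin 2) (Fin 2) ℂ) → Matrix (Fin 2) (Fin 2) ℂ :=
    fun A => ((frameTw F n K h W A y : (Matrix (Fin 2) (Fin 2) ℂ)ˣ) : Matrix (Fin 2) (Fin 2) ℂ) with hw
  -- `A = iX` with `X := −iA` Hermitian traceless
  set X : PBond (F.P K) 0 → Matrix (Fin 2) (Fin 2) ℂ := fun b => (-Complex.I) • A b with hXdef
  have hX : ∀ b, (X b).IsHermitian ∧ (X b).trace = 0 := fun b => by
    refine ⟨?_, ?_⟩
    · have h1 : star (A b) = -A b := (skewAdjoint.mem_iff).1 (hA b)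
      show (((-Complex.I) • A b))ᴴ = (-Complex.I) • A b
      rw [Matrix.conjTranspose_smul, ← Matrix.star_eq_conjTranspose, h1, star_neg, Complex.star_def, Complex.conj_I, neg_neg, smul_neg, neg_smul]
    · show ((-Complex.I) • A b).trace = 0
      rw [Matrix.trace_smul, htr b, smul_zero]
  have hAX : (fun b => Complex.I • X b) = A := by
    funext b; rw [hXdef]; dsimp only; rw [smul_smul, mul_neg, Complex.I_mul_I, neg_neg, one_smul]
  -- the curve `γ(t) := ↑w_{tA}(y)`
  set γ : ℝ → Matrix (Fin 2) (Fin 2) ℂ := fun t => w ((t : ℂ) • A) with hγ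
  have hS : ∀ᶠ t : ℝ in 𝓝 0, γ t ∈ (Matrix.specialUnitaryGroup (Fin 2) ℂ : Set (Matrix (Fin 2) (Fin 2) ℂ)) := by
    have h1 := frameTw_real_smul_mem_specialUnitaryGroup_eventually F h hε₀ hε W hreg X hX y
    rw [hAX] at h1
    exact h1
  have hγ0 : γ 0 = 1 := by
    simp only [hγ, hw, Complex.ofReal_zero, zero_smul, frameTw_zero, Units.val_one]
  -- its velocity at `0` is `r(y)A`
  have hline : HasDerivAt (fun t : ℝ => (t : ℂ) • A) A 0 := by
    have h1 := (Complex.ofRealCLM.hasDerivAt (x := (0 : ℝ))).smul_const A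
    simpa only [Complex.ofRealCLM_apply, Complex.ofReal_one, one_smul] using h1
  have hγ' : HasDerivAt γ (fderiv ℂ w 0 A) 0 := by
    obtain ⟨hα3, hα4, hexp, -, -⟩ := windows_of_ten7 F (K := K) hε₀.le hε
    have hF := hasFDerivAt_frameTw_of_regPr F h hε₀ hα3 hα4 hexp W hreg y
    have h0 : (0 : PBond (F.P K) 0 → Matrix (Fin 2) (Fin 2) ℂ) = (fun t : ℝ => (t : ℂ) • A) 0 := by simp only [Complex.ofReal_zero, zero_smul]
    have h1 := (hF.restrictScalars ℝ).comp_hasDerivAt_of_eq (0 : ℝ) hline h0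
    simpa only [Function.comp_def, ContinuousLinearMap.coe_restrictScalars'] using h1
  -- closed-subgroup velocity lemma
  have hlie := MatrixLie.mem_lieSet_of_hasDerivAt B12SemisimpleNormalTori.isClosedUnitaryGroup_specialUnitaryGroup hS hγ0 hγ'
  rw [MatrixLie.mem_lieSet] at hlie
  have h2 := (LogChartClosedSubgroup.mem_su_iff_forall_exp_mem_specialUnitaryGroup (n := Fin 2)).2 hlie
  exact ⟨(skewAdjoint.mem_iff).2 h2.1, h2.2⟩

end Summit.QuantumFields.YangMills.Theorems.Prop7FrameResponseCombSU2

end
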